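import Mathlib
import Summits.Ventures.HodgeRepro2.Tier7.Line1.Defs
import Summits.Ventures.HodgeRepro2.Tier7.Common.Datum

/-!
# Tier7/Line1/CupProduct — LINE 1 (t7-L1-p1): the registered lemma `stable_eq_iSup_irred`, `P_A = ω(μ_0)·ω(μ_1)`,
the displayed `L²`-orthogonality `OrthDistinct`, and the pairing criterion for «`Π ⊆ P_A`»

PROVED (no `sorry`; axioms propext / Classical.choice / Quot.sound), over the FROZEN datum (Target.lean 6e511b88…):
* `stable_eq_iSup_irred` — the registered p1 lemma of Skeleton §8 (LEMMAS.md v3/v4 §3), discharged by the landed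
  `socle_eq_self` (Tier7/Common/Hecke.lean, t7-typer-1 p661196); the statement is kept under the line's name.
* `prodModS_eq_mul : prodModS D = D.omega 0 * D.omega 1` (and `prodModSbar_eq_mul` for the corners 2, 3): the Hecke
  module generated by the wedges `θ(μ_0) ∧ θ(μ_1)` over ALL translates is the CUP-PRODUCT IMAGE `ω(μ_0)·ω(μ_1)` of the
  two theta-lift summands — from (H3) and the irreducibility (H8) `omega_irred` (Hecke density: the orbit of
  `θ(μ_i) ≠ 0` spans `ω(μ_i)`, `PeriodDatum.heckeSpan_thetaBase` of Common/Datum). So `P_A ≠ ⊥` is exactly «the cup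
  product `ω(μ_0) ⊗ ω(μ_1) → H^{2,0}` is not zero».
* the DISPLAYED `OrthDistinct D` (statement verbatim = Skeleton v7 §8, the tower hypothesis of t7-L1-p5's converse) —
  two DISTINCT Hecke-irreducible subspaces of `H^{1,0} ∧ H^{1,0}` are orthogonal for the
  Hodge pairing `L2 a b = ∫_X a ∧ b̄`. Printed inputs: the orthogonal Hilbert direct sum `L²(Γ\G) = ⊕ m(π) H_π`
  (Deitmar–Echterhoff 2014 Thm 9.2.2, lit-4 C-L4-20; Borel–Wallach VII 3.1 (2), C-L4-17; Liu 2021 App. B.1, lit-1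
  L1.17) + Schur (non-isomorphic irreducible closed subrepresentations of a unitary representation are orthogonal) +
  the realisation of Matsushima's isomorphism by HARMONIC forms (Petersson = Hodge inner product; Borel–Wallach VII
  2.10 / 3.2). NOT printed as one sentence on the record (lit-1 L1.17 (c)) — displayed as the line's own field, never
  cited as «Liu (D.1)»; implied by finite-dimensionality of `H^{1,0} ∧ H^{1,0}` through (H9)/(H10) (t7-L1-p5's
  lane); vacuous in the square-zero datum.
* `le_of_L2_ne_zero`: an irreducible `W ⊆ H^{2,0}` not `L²`-orthogonal to a Hecke-stable `U ⊆ H^{2,0}` lies in `U`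
  (via `stable_eq_iSup_irred` = `socle_eq_self`).
* THE PAIRING CRITERION `le_prodModS_iff_L2` (given `OrthDistinct`): an irreducible `Π ⊆ H^{2,0}` lies in `P_A` iff some
  translated wedge `θ(μ_0) ∧ θ(μ_1)` pairs non-trivially with `Π` — i.e. `Ξ_A = {Π : ⟨f^*Ω_s, Π⟩_{L²} ≠ 0}`; the same
  for `P_B`; and `commonIrred_iff_L2`: `CommonIrred D` iff one irreducible `Π` pairs non-trivially with BOTH wedge
  orbits — «`Ξ_A ∩ Ξ_B ≠ ∅`» in the datum's own vocabulary.

§8(d): uses an L-value-free non-vanishing device: NO (module theory and bilinear algebra over the frozen fields; no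
non-vanishing is proved). Author: t7-L1-p1 (prover-pub-hodge-repro2-t7-L1-p1-g0-0).
-/
namespace Summit.Ventures.HodgeRepro2.Tier7.Line1

open Summit.Ventures.HodgeRepro2.Tier7

open scoped Pointwise

noncomputable section

variable {K : Type} [Field K] [NumberField K] {E' : Type} [Field E'] [NumberField E']
  {V : Type} [AddCommGroup V] [Module E' V] {HX : Type} [Ring HX] [Algebra ℂ HX]
  {G : Type} [Group G] [MulAction G HX] (D : PeriodDatum K E' V HX G)

/-! ### 1. The registered p1 lemma `stable_eq_iSup_irred` (discharged by the landed `socle_eq_self`) -/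

/-- **(t7-L1-p1; the registered lemma of Skeleton §8, PROVED from (H9) alone)** SEMISIMPLICITY IN THE FORM THE SEESAW
USES: a Hecke-stable `U ≤ H10 * H10` is the sum of the Hecke-irreducible subspaces it contains. The right-hand side is
`socle G U` by definition, and the statement is the landed `Summit.Ventures.HodgeRepro2.Tier7.socle_eq_self` of
`Tier7/Common/Hecke.lean` (t7-typer-1, p661196, 19:27Z) — the same argument (complement of the socle from (H9), `U ⊓ Σ'`
Hecke-stable with no irreducible hence `⊥`, modular law); this seat's independent proof of the identical statement is
the HOME read copy route/t7/Line1/p1/Semisimple.lean (4c52b7d9…, rc 0, axioms trio) and is NOT re-landed. -/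
theorem stable_eq_iSup_irred {U : Submodule ℂ HX} (hle : U ≤ D.S.H10 * D.S.H10) (hs : HeckeStable G U) :
    U = ⨆ W : {W : Submodule ℂ HX // W ≤ U ∧ HeckeIrred G W}, (W : Submodule ℂ HX) :=
  (socle_eq_self D.S hle hs).symm

/-! ### 2. `P_A = ω(μ_0)·ω(μ_1)`: the Hecke module of the wedges is the cup product of the two theta-lift summands -/

/-- the set of wedges `θ(μ_0) ∧ θ(μ_1)` over all translates is the product set of the two Hecke orbits -/
theorem range_fOmegaS : Set.range D.fOmegaS =
    (Set.range fun g : G => g • D.thetaBase 0) * (Set.range fun g : G => g • D.thetaBase 1) := by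
  ext x
  constructor
  · rintro ⟨g, rfl⟩
    exact ⟨_, ⟨g 0, rfl⟩, _, ⟨g 1, rfl⟩, rfl⟩
  · rintro ⟨_, ⟨g0, rfl⟩, _, ⟨g1, rfl⟩, rfl⟩
    exact ⟨![g0, g1, 1, 1], by simp [PeriodDatum.fOmegaS, PeriodDatum.theta, PeriodDatum.thetaBase]⟩

/-- the same for the corners 2, 3 -/
theorem range_fOmegaSbar : Set.range D.fOmegaSbar =
    (Set.range fun g : G => g • D.thetaBase 2) * (Set.range fun g : G => g • D.thetaBase 3) := by
  ext x
  constructor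
  · rintro ⟨g, rfl⟩
    exact ⟨_, ⟨g 2, rfl⟩, _, ⟨g 3, rfl⟩, rfl⟩
  · rintro ⟨_, ⟨g2, rfl⟩, _, ⟨g3, rfl⟩, rfl⟩
    exact ⟨![1, 1, g2, g3], by simp [PeriodDatum.fOmegaSbar, PeriodDatum.theta, PeriodDatum.thetaBase]⟩

/-- **`P_A = ω(μ_0)·ω(μ_1)`**: the Hecke module generated by the wedges `θ(μ_0) ∧ θ(μ_1)` over all translates is the
cup-product image of the two theta-lift summands (uses (H3) and (H8) `omega_irred` through the landed Hecke density
`PeriodDatum.heckeSpan_thetaBase`). -/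
theorem prodModS_eq_mul : prodModS D = D.omega 0 * D.omega 1 := by
  unfold prodModS
  rw [range_fOmegaS, ← Submodule.span_mul_span]
  exact congrArg₂ (· * ·) (D.heckeSpan_thetaBase 0) (D.heckeSpan_thetaBase 1)

/-- **`P_B = ω(μ_2)·ω(μ_3)`** -/
theorem prodModSbar_eq_mul : prodModSbar D = D.omega 2 * D.omega 3 := by
  unfold prodModSbar
  rw [range_fOmegaSbar, ← Submodule.span_mul_span]
  exact congrArg₂ (· * ·) (D.heckeSpan_thetaBase 2) (D.heckeSpan_thetaBase 3)

/-! ### 3. `L²`-orthogonality of distinct constituents (DISPLAYED: `OrthDistinct`, the statement of Skeleton v7 §8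
verbatim) and «non-orthogonal ⇒ contained» -/

/-- **THE (D.1)-DECOMPOSITION OF `H^{2,0}(X_∞)` IS `L²`-ORTHOGONAL** (displayed; the tower hypothesis of Skeleton v7 §8,
statement verbatim): two DISTINCT Hecke-irreducible subspaces of `H^{1,0} ∧ H^{1,0}` are orthogonal for the Hodge
pairing `L2 a b = ∫_X a ∧ b̄`. Printed inputs: the orthogonal Hilbert direct sum `L²(Γ\G) = ⊕ m(π) H_π`
(Deitmar–Echterhoff 2014 Thm 9.2.2, lit-4 C-L4-20; Borel–Wallach VII 3.1 (2), C-L4-17; Liu 2021 App. B.1 / (D.1) with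
multiplicity one, lit-1 L1.17) + Schur (non-isomorphic irreducible closed subrepresentations of a unitary
representation are orthogonal) + the harmonic-form realisation of Matsushima's isomorphism (Petersson = Hodge inner
product, Borel–Wallach VII 2.10 / 3.2). NOT printed as one sentence on the record (lit-1 L1.17 (c)) — displayed as the
line's own hypothesis, never cited as «Liu (D.1)»; on finite-dimensional data it follows from (H10) through the
`L²`-orthogonal projection (t7-L1-p5 / Common/OrthProj); vacuous in the square-zero datum. -/
def OrthDistinct : Prop :=
  ∀ W W' : Submodule ℂ HX, HeckeIrred G W → HeckeIrred G W' → W ≤ D.S.H10 * D.S.H10 → W' ≤ D.S.H10 * D.S.H10 →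
    W ≠ W' → ∀ a ∈ W, ∀ b ∈ W', D.S.L2 a b = 0

/-- an irreducible `W ⊆ H^{2,0}` that is NOT `L²`-orthogonal to a Hecke-stable `U ⊆ H^{2,0}` lies in `U`
(`U` is the sum of its irreducibles, each of which is either `W` or orthogonal to it). -/
theorem le_of_L2_ne_zero (ho : OrthDistinct D) {W U : Submodule ℂ HX} (hW : HeckeIrred G W)
    (hWle : W ≤ D.S.H10 * D.S.H10) (hU : U ≤ D.S.H10 * D.S.H10) (hUs : HeckeStable G U)
    {w f : HX} (hw : w ∈ U) (hf : f ∈ W) (hne : D.S.L2 w f ≠ 0) : W ≤ U := by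
  by_contra hnle
  apply hne
  rw [stable_eq_iSup_irred D hU hUs] at hw
  refine Submodule.iSup_induction _ (motive := fun x => D.S.L2 x f = 0) hw ?_ ?_ ?_
  · rintro ⟨W', hW'U, hW'⟩ a ha
    have hne' : W' ≠ W := fun h => hnle (h ▸ hW'U)
    exact ho W' W hW' hW (hW'U.trans hU) hWle hne' a ha f hf
  · exact L2_zero_left D.S f
  · intro x y hx hy
    rw [L2_add_left, hx, hy, add_zero]


/-! ### The pairing criterion for membership in `P_A`, `P_B` (given `OrthDistinct`) -/

/-- **THE PAIRING CRITERION** (given `OrthDistinct`): a Hecke-irreducible `W ⊆ H^{2,0}` lies in `P_A` iff some Hecke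
translate of the wedge `θ(μ_0) ∧ θ(μ_1)` pairs non-trivially with `W`. `→`: a non-zero `f ∈ W ⊆ P_A` has
`∫ f ∧ f̄ ≠ 0` (H4) and is a combination of translated wedges; `←`: `le_of_L2_ne_zero`. -/
theorem le_prodModS_iff_L2 (ho : OrthDistinct D) {W : Submodule ℂ HX} (hW : HeckeIrred G W)
    (hWle : W ≤ D.S.H10 * D.S.H10) :
    W ≤ prodModS D ↔ ∃ (g : Fin 4 → G) (f : HX), f ∈ W ∧ D.S.L2 (D.fOmegaS g) f ≠ 0 := by
  constructor
  · intro hle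
    obtain ⟨f, hfW, hfne⟩ := (Submodule.ne_bot_iff _).mp hW.1
    have hL2 : D.S.L2 f f ≠ 0 := D.S.L2_self_ne_zero (hWle hfW) hfne
    have key : ∀ w ∈ prodModS D, D.S.L2 w f ≠ 0 → ∃ g : Fin 4 → G, D.S.L2 (D.fOmegaS g) f ≠ 0 := by
      intro w hw
      induction hw using Submodule.span_induction with
      | mem x hx =>
        obtain ⟨g, rfl⟩ := hx
        exact fun h => ⟨g, h⟩
      | zero => intro h; exact absurd (L2_zero_left D.S f) h
      | add x y _ _ hx hy =>
        intro hxy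
        by_cases hx0 : D.S.L2 x f = 0
        · apply hy
          intro h
          apply hxy
          rw [L2_add_left, hx0, h, add_zero]
        · exact hx hx0
      | smul z x _ hx =>
        intro hzx
        apply hx
        intro h
        apply hzx
        rw [L2_smul_left, h, mul_zero]
    obtain ⟨g, hg⟩ := key f (hle hfW) hL2
    exact ⟨g, f, hfW, hg⟩
  · rintro ⟨g, f, hfW, hne⟩
    exact le_of_L2_ne_zero D ho hW hWle (prodModS_le D) (prodModS_stable D)
      (Submodule.subset_span ⟨g, rfl⟩) hfW hne

/-- the pairing criterion for `P_B` -/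
theorem le_prodModSbar_iff_L2 (ho : OrthDistinct D) {W : Submodule ℂ HX} (hW : HeckeIrred G W)
    (hWle : W ≤ D.S.H10 * D.S.H10) :
    W ≤ prodModSbar D ↔ ∃ (g : Fin 4 → G) (f : HX), f ∈ W ∧ D.S.L2 (D.fOmegaSbar g) f ≠ 0 := by
  constructor
  · intro hle
    obtain ⟨f, hfW, hfne⟩ := (Submodule.ne_bot_iff _).mp hW.1
    have hL2 : D.S.L2 f f ≠ 0 := D.S.L2_self_ne_zero (hWle hfW) hfne
    have key : ∀ w ∈ prodModSbar D, D.S.L2 w f ≠ 0 →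
        ∃ g : Fin 4 → G, D.S.L2 (D.fOmegaSbar g) f ≠ 0 := by
      intro w hw
      induction hw using Submodule.span_induction with
      | mem x hx =>
        obtain ⟨g, rfl⟩ := hx
        exact fun h => ⟨g, h⟩
      | zero => intro h; exact absurd (L2_zero_left D.S f) h
      | add x y _ _ hx hy =>
        intro hxy
        by_cases hx0 : D.S.L2 x f = 0
        · apply hy
          intro h
          apply hxy
          rw [L2_add_left, hx0, h, add_zero]
        · exact hx hx0
      | smul z x _ hx =>
        intro hzx
        apply hx
        intro h
        apply hzx
        rw [L2_smul_left, h, mul_zero]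
    obtain ⟨g, hg⟩ := key f (hle hfW) hL2
    exact ⟨g, f, hfW, hg⟩
  · rintro ⟨g, f, hfW, hne⟩
    exact le_of_L2_ne_zero D ho hW hWle (prodModSbar_le D) (prodModSbar_stable D)
      (Submodule.subset_span ⟨g, rfl⟩) hfW hne

/-- **«`Ξ_A ∩ Ξ_B ≠ ∅`» in the datum's vocabulary** (given `OrthDistinct`): the crux `CommonIrred D` holds iff ONE
Hecke-irreducible `Π ⊆ H^{2,0}` pairs non-trivially with a translate of `θ(μ_0) ∧ θ(μ_1)` AND with a translate of
`θ(μ_2) ∧ θ(μ_3)` (via `commonIrred_iff_inf_ne_bot`, (H9), (H10)). -/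
theorem commonIrred_iff_L2 (ho : OrthDistinct D) :
    CommonIrred D ↔ ∃ W : Submodule ℂ HX, W ≤ D.S.H10 * D.S.H10 ∧ HeckeIrred G W ∧
      (∃ (g : Fin 4 → G) (f : HX), f ∈ W ∧ D.S.L2 (D.fOmegaS g) f ≠ 0) ∧
      (∃ (g : Fin 4 → G) (f : HX), f ∈ W ∧ D.S.L2 (D.fOmegaSbar g) f ≠ 0) := by
  constructor
  · intro hc
    have hinf := inf_ne_bot_of_common_irred D hc
    obtain ⟨W, hWle, hW⟩ := exists_irred_le_of_stable D (inf_le_left.trans (prodModS_le D))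
      (heckeStable_inf (prodModS_stable D) (prodModSbar_stable D)) hinf
    have hWle' : W ≤ D.S.H10 * D.S.H10 := hWle.trans (inf_le_left.trans (prodModS_le D))
    exact ⟨W, hWle', hW, (le_prodModS_iff_L2 D ho hW hWle').mp (hWle.trans inf_le_left),
      (le_prodModSbar_iff_L2 D ho hW hWle').mp (hWle.trans inf_le_right)⟩
  · rintro ⟨W, hWle, hW, hA, hB⟩
    exact commonIrred_of_irred_le_inf D W hW ((le_prodModS_iff_L2 D ho hW hWle).mpr hA)
      ((le_prodModSbar_iff_L2 D ho hW hWle).mpr hB)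

end

end Summit.Ventures.HodgeRepro2.Tier7.Line1
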